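import Mathlib
import Summits.Ventures.PercRepro2.LocRows
import Summits.Ventures.PercRepro2.SwRow
import Summits.Ventures.PercRepro2.SwOut
import Summits.Ventures.PercRepro2.SwAllRow
import Summits.Ventures.PercRepro2.SwOutAll
import Summits.Ventures.PercRepro2.SwOutArmFlip
import Summits.Ventures.PercRepro2.SwOutArms
import Summits.Ventures.PercRepro2.SwOutArmOrbit
import Summits.Ventures.PercRepro2.SwOutArmCube
import Summits.Ventures.PercRepro2.SwOutArmThm
import Summits.Ventures.PercRepro2.SwOutCoreDefs
import Summits.Ventures.PercRepro2.SwOutCoreKey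
import Summits.Ventures.PercRepro2.SwOutBigBlockDefs
import Summits.Ventures.PercRepro2.SwOutMixedBaseDefs
import Summits.Ventures.PercRepro2.SwOutMixedBaseClasses
import Summits.Ventures.PercRepro2.SwOutMixedBaseHull
import Summits.Ventures.PercRepro2.SwOutMixedBaseDual
import Summits.Ventures.PercRepro2.SwOutMixedCore
import Summits.Ventures.PercRepro2.SwOutMixedCoreMoves
import Summits.Ventures.PercRepro2.SwOutMixedPartCoreKey
import Summits.Ventures.PercRepro2.SwOutMixedPartOrbitDefs
import Summits.Ventures.PercRepro2.SwOutMixedPartEsc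

/-!
# The base read off an escaping point (blind cell PercRepro2, night-4 g19, 2026-08-27;
proofs/NIGHT4-G19.md §5 (iii))

The KEY of the mixed kind at an escaping point must be computed from the point alone: `baseE ζ`
is the all-red orientation of `ζ` with the u–p edges made red and the outside edges of `p` (the
edges from `p` to vertices outside the hull of `h`, other than `u`) made blue.  At every escaping
point of the raw cube of a mixed base with connected arms this recovers the base
(**`baseE_esc`**): the all-red orientation is the flip of the blue side, which contains or misses
every arm (`U_subset_blueSide_iff`, …), so the arm edges carry the base colour, and the u–p and
outside edges are overridden.  Also `mixedReal_top`: the all-true point realises the base.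
-/

namespace Summit.Ventures.PercRepro2

namespace BigBlock

open Hull LocRows

variable {V : Type*} {E : Type*} [Fintype E] [DecidableEq E]

open scoped Classical

section Defs

variable (ends : E → Sym2 V) (h u p : V)

/-- The base read off a configuration: the all-red orientation with the u–p edges red and the
outside edges of `p` blue. -/
noncomputable def baseE (ζ : Config E) : Config E :=
  fun e => if ends e = s(u, p) then true
    else if ∃ z, ends e = s(p, z) ∧ z ≠ u ∧ z ∉ hull ends ζ h then false
    else allRed ends ζ h e

end Defs

section Base

variable {ι κ : Type*} {ends : E → Sym2 V} {σ : Config E} {h u p : V} {U : ι → Set V} {Ah : Set V}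
  {F : κ → Set V}

omit [Fintype E] [DecidableEq E] in
/-- The all-true point realises the base. -/
lemma mixedReal_top (σ : Config E) :
    mixedReal ends u p U Ah F σ ((fun _ => true), true, true, true, fun _ => true) = σ := by
  funext e
  unfold mixedReal
  rw [if_neg]
  rintro ((((⟨_, h1, _⟩ | ⟨h1, _⟩) | ⟨h1, _⟩) | ⟨h1, _⟩) | ⟨_, h1, _⟩) <;> exact Bool.noConfusion h1

omit [Fintype E] [DecidableEq E] in
/-- The all-true point is a core point. -/
lemma core_top : Core (((fun _ => true), true, true, true, fun _ => true) : Pt ι κ) := ⟨rfl, rfl⟩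

variable (hb : MixedBase ends σ h u p U Ah F)
include hb

omit [Fintype E] [DecidableEq E] in
/-- A u-arm lies on the blue side iff it is blue. -/
lemma MixedBase.U_subset_blueSide_iff (hup : ∃ e, ends e = s(u, p)) {q : Pt ι κ}
    (hqB : ¬ LeakB q) (j : ι) :
    U j ⊆ cluster ends (blue (mixedReal ends u p U Ah F σ q)) h \ {h} ↔ q.1 j = false := by
  rw [hb.cluster_blue_mixedReal hup hqB]
  constructor
  · intro hsub
    obtain ⟨x, hx⟩ := hb.U_nonempty j
    have := (hsub hx).1
    rw [mem_redSetM_iff] at this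
    rcases this with h1 | ⟨j', hj', hx'⟩ | ⟨h1, _⟩ | ⟨h1, _⟩ | ⟨_, h1⟩ | ⟨k, _, h1⟩
    · exact absurd (h1 ▸ hx) (hb.h_notMem_U j)
    · by_cases hjj : j = j'
      · subst hjj; simpa [flipPt, flipAll] using hj'
      · exact absurd hx' (hb.U_disj j j' hjj x hx)
    · exact absurd (h1 ▸ hx) (hb.u_notMem_U j)
    · exact absurd (h1 ▸ hx) (hb.p_notMem_U j)
    · exact absurd h1 (hb.U_disj_Ah j x hx)
    · exact absurd h1 (hb.U_disj_F j k x hx)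
  · intro hj x hx
    refine ⟨?_, fun h' => hb.h_notMem_U j (Set.mem_singleton_iff.1 h' ▸ hx)⟩
    rw [mem_redSetM_iff]
    exact Or.inr (Or.inl ⟨j, by simp [flipPt, flipAll, hj], hx⟩)

omit [Fintype E] [DecidableEq E] in
/-- The h-piece lies on the blue side iff it is blue. -/
lemma MixedBase.Ah_subset_blueSide_iff (hup : ∃ e, ends e = s(u, p)) {q : Pt ι κ}
    (hqB : ¬ LeakB q) :
    Ah ⊆ cluster ends (blue (mixedReal ends u p U Ah F σ q)) h \ {h} ↔ q.2.1 = false := by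
  rw [hb.cluster_blue_mixedReal hup hqB]
  constructor
  · intro hsub
    obtain ⟨x, hx⟩ := hb.Ah_nonempty
    have := (hsub hx).1
    rw [mem_redSetM_iff] at this
    rcases this with h1 | ⟨j, _, hx'⟩ | ⟨h1, _⟩ | ⟨h1, _⟩ | ⟨ha, _⟩ | ⟨k, _, h1⟩
    · exact absurd (h1 ▸ hx) hb.h_notMem_Ah
    · exact absurd hx (hb.U_disj_Ah j x hx')
    · exact absurd (h1 ▸ hx) hb.u_notMem_Ah
    · exact absurd (h1 ▸ hx) hb.p_notMem_Ah
    · simpa [flipPt] using ha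
    · exact absurd h1 (hb.Ah_disj_F k x hx)
  · intro ha x hx
    refine ⟨?_, fun h' => hb.h_notMem_Ah (Set.mem_singleton_iff.1 h' ▸ hx)⟩
    rw [mem_redSetM_iff]
    exact Or.inr (Or.inr (Or.inr (Or.inr (Or.inl ⟨by simp [flipPt, ha], hx⟩))))

omit [Fintype E] [DecidableEq E] in
/-- A far arm lies on the blue side iff it is blue. -/
lemma MixedBase.F_subset_blueSide_iff (hup : ∃ e, ends e = s(u, p)) {q : Pt ι κ}
    (hqB : ¬ LeakB q) (k : κ) :
    F k ⊆ cluster ends (blue (mixedReal ends u p U Ah F σ q)) h \ {h} ↔ q.2.2.2.2 k = false := by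
  rw [hb.cluster_blue_mixedReal hup hqB]
  constructor
  · intro hsub
    obtain ⟨x, hx⟩ := hb.F_nonempty k
    have := (hsub hx).1
    rw [mem_redSetM_iff] at this
    rcases this with h1 | ⟨j, _, hx'⟩ | ⟨h1, _⟩ | ⟨h1, _⟩ | ⟨_, h1⟩ | ⟨k', hk', hx'⟩
    · exact absurd (h1 ▸ hx) (hb.h_notMem_F k)
    · exact absurd hx (hb.U_disj_F j k x hx')
    · exact absurd (h1 ▸ hx) (hb.u_notMem_F k)
    · exact absurd (h1 ▸ hx) (hb.p_notMem_F k)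
    · exact absurd hx (hb.Ah_disj_F k x h1)
    · by_cases hkk : k = k'
      · subst hkk; simpa [flipPt, flipAll] using hk'
      · exact absurd hx' (hb.F_disj k k' hkk x hx)
  · intro hk x hx
    refine ⟨?_, fun h' => hb.h_notMem_F k (Set.mem_singleton_iff.1 h' ▸ hx)⟩
    rw [mem_redSetM_iff]
    exact Or.inr (Or.inr (Or.inr (Or.inr (Or.inr ⟨k, by simp [flipPt, flipAll, hk], hx⟩))))

omit [Fintype E] [DecidableEq E] in
/-- **The base read off an escaping point is the base.** -/
theorem MixedBase.baseE_esc [Nonempty ι] (hup : ∃ e, ends e = s(u, p))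
    (hdead : ∃ e y, ends e = s(p, y) ∧ y ∈ Ah)
    (hconnU : ∀ j, ∀ x ∈ U j, ∀ y ∈ U j,
      y ∈ cluster ends (fun e => decide (e ∈ within ends (U j))) x)
    (hconnA : ∀ x ∈ Ah, ∀ y ∈ Ah, y ∈ cluster ends (fun e => decide (e ∈ within ends Ah)) x)
    (hconnF : ∀ k, ∀ x ∈ F k, ∀ y ∈ F k,
      y ∈ cluster ends (fun e => decide (e ∈ within ends (F k))) x)
    {q : Pt ι κ} (hqR : ¬ LeakR q) (hqB : ¬ LeakB q) (hq : D q ∨ Pair q) :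
    baseE ends h u p (mixedReal ends u p U Ah F σ q) = σ := by
  have hc : CoreFree ends (mixedReal ends u p U Ah F σ q) h :=
    hb.coreFree_of_unmixed hup hqR hqB (unmixed_of_esc hq)
  -- the all-red orientation is the flip of the blue side, a cube point
  have hW := armClosed_blueSide hc
  have hall : allRed ends (mixedReal ends u p U Ah F σ q) h = mixedReal ends u p U Ah F σ
      (toggleW u p U Ah F q (cluster ends (blue (mixedReal ends u p U Ah F σ q)) h \ {h})) :=
    hb.flip_armClosed_eq_mixedReal hup hdead hconnU hconnA hconnF hqR hqB hW
  funext e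
  unfold baseE
  by_cases h1 : ends e = s(u, p)
  · rw [if_pos h1, hb.u_red e p h1]
  rw [if_neg h1]
  by_cases h2 : ∃ z, ends e = s(p, z) ∧ z ≠ u ∧ z ∉ hull ends (mixedReal ends u p U Ah F σ q) h
  · rw [if_pos h2]
    obtain ⟨z, hpz, hzu, hzH⟩ := h2
    have hzA : z ∉ Ah := fun hz => hzH (hb.armsAll_subset_hull hup hqR hqB (Or.inl (Or.inr hz)))
    rw [hb.ext_blue e z hpz hzu hzA]
  rw [if_neg h2, hall]
  -- the edge is an arm edge or in no class
  by_cases hU : ∃ j, e ∈ touches ends (U j)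
  · obtain ⟨j, hj⟩ := hU
    rw [hb.mixedReal_apply_U hj]
    simp only [toggleW, hb.U_subset_blueSide_iff hup hqB j]
    cases q.1 j <;> simp
  by_cases hA : e ∈ touches ends Ah
  · rw [hb.mixedReal_apply_Ah hA]
    simp only [toggleW, hb.Ah_subset_blueSide_iff hup hqB]
    cases q.2.1 <;> simp
  by_cases hF : ∃ k, e ∈ touches ends (F k)
  · obtain ⟨k, hk⟩ := hF
    rw [hb.mixedReal_apply_F hk]
    simp only [toggleW, hb.F_subset_blueSide_iff hup hqB k]
    cases q.2.2.2.2 k <;> simp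
  have hUP : e ∉ clsUP ends u p := h1
  have hX : e ∉ clsExt ends u p Ah := by
    rintro ⟨z, hpz, hzu, hzA⟩
    refine h2 ⟨z, hpz, hzu, fun hzH => ?_⟩
    have := hb.hull_mixedReal_subset hup hqR hqB hzH
    rcases hb.p_edges e z hpz with hz | hz | ⟨_, _, hz⟩
    · exact hzu hz
    · exact hzA hz
    · rcases this with ((h3 | h3) | h3) | h3
      · exact ‹z ≠ h› h3
      · exact hzu h3
      · exact ‹z ≠ p› h3
      · exact hz h3
  have hU' : ∀ j, e ∉ touches ends (U j) := fun j hj => hU ⟨j, hj⟩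
  have hF' : ∀ k, e ∉ touches ends (F k) := fun k hk => hF ⟨k, hk⟩
  exact MixedBase.mixedReal_apply_none hU' hA hUP hX hF'

end Base

end BigBlock

end Summit.Ventures.PercRepro2
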